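import Mathlib
import Summits.NavierStokesRegularity.FluidComputer.GalerkinEmergenceTrue
import HarnessLib

/-!
# The UPPER half of the bootstrap at a Galerkin level: `‖u t‖ ≤ (3/2) ε e^{λt}` (instab g19, cell `ns-blowup`, 2026-08-27)

HONEST FRAMING (human ruling D-0035): nothing here is a claim about Navier–Stokes blow-up.
WHAT THIS IS NOT: not NS — an abstract real-analysis sentence about classical solutions of
`u' = A u + B(u, u)` with a bounded generator on an inner-product space; no flow or certificate is
constructed.

PURPOSE. `GalerkinEmergenceTrue.half_prediction_of_classical_slack` (g15) records the FLOOR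
`‖u t‖ ≥ ε e^{λt}/2` of the KEEP bootstrap at a Galerkin level; the same bootstrap
(`GalerkinEmergenceLimit.floor_of_mild_slack`, two-sided) also gives the CEILING
`‖u t‖ ≤ ε e^{λt} + C'((3/2) ε e^{λt})² ≤ (3/2) ε e^{λt}` on the whole window. The ceiling is what
instab g19's residence files consume: it is the level-uniform `H²` bound `r = (3/2) ε e^{λT}` of
`TransportGalerkinEmergenceH2.half_prediction_nsField_of_levelBound` /
`TransportGalerkinAbcH2.exists_keep_eigenvector_abc_of_levelBound` for every level whose slack is
absorbed by the margin (all large levels; `GalerkinEmergenceLimit.linear_prediction_slack`). With it,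
RESIDENCE (β3) of `HOME/instab/BETA2-SPEC.md` §6 is supplied by the chain itself.

* `norm_le_three_halves_of_classical_slack` — the ceiling, hypotheses verbatim those of
  `half_prediction_of_classical_slack` (minus the threshold clause `hχ`).
-/

noncomputable section

namespace Summit.NavierStokesRegularity.FluidComputer.GalerkinEmergenceUpper

open Set Filter Topology MeasureTheory intervalIntegral NormedSpace RCLike
open scoped InnerProductSpace
open Summit.NavierStokesRegularity.FluidComputer.EmergenceMildDuhamel
open Summit.NavierStokesRegularity.FluidComputer.StabilityMildDuhamel
open Summit.NavierStokesRegularity.FluidComputer.BoundedGeneratorDuhamel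
open Summit.NavierStokesRegularity.FluidComputer.BoundedGeneratorEmergence
open Summit.NavierStokesRegularity.FluidComputer.GalerkinEmergenceLimit
open Summit.NavierStokesRegularity.FluidComputer.GalerkinEmergenceTrue

variable {𝕜 E : Type*} [RCLike 𝕜] [NormedAddCommGroup E] [InnerProductSpace 𝕜 E]
  [NormedSpace ℝ E] [CompleteSpace E]

/-- **The ceiling of the KEEP bootstrap at a Galerkin level.** Under the hypotheses of
`GalerkinEmergenceTrue.half_prediction_of_classical_slack` — two-level certificate (`ω, c, m₂, M₁`;
`G₁, G₂, D₁`) for the bounded generator `A`, the bilinear loss (B) with `c_alg`, `2λ > ω`, `λ ≥ 0`,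
`ε > 0`, a classical solution `u` of `u' = A u + B(u, u)` on `[0, T₀]` whose linear prediction is
`ε e^{λt}` up to the slack `η`, a margin `C'` absorbing the slack, and the window condition
`C' (3/2)² ε e^{λt} < 1/2` — the solution stays BELOW `(3/2) ε e^{λt}` on the whole window:

  `‖u t‖ ≤ ε e^{λt} + C' ((3/2) ε e^{λt})² ≤ (3/2) ε e^{λt}`.

This is the level-uniform `H²` bound of the R-β chain's residence files. -/
theorem norm_le_three_halves_of_classical_slack (A : E →L[ℝ] E) (B : E → E → E)
    {G₁ G₂ D₁ : E →L[ℝ] E}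
    (hG₁ : ∀ x y : E, ⟪G₁ x, y⟫_𝕜 = ⟪x, G₁ y⟫_𝕜) (hG₂ : ∀ x y : E, ⟪G₂ x, y⟫_𝕜 = ⟪x, G₂ y⟫_𝕜)
    (hG₁pos : ∀ x : E, 0 ≤ re ⟪G₁ x, x⟫_𝕜) {ω c m₂ M₁ : ℝ} (hc : 0 < c) (hm₂ : 0 < m₂)
    (hM₁ : 0 ≤ M₁) (hm₂' : ∀ x : E, m₂ * ‖x‖ ^ 2 ≤ re ⟪G₂ x, x⟫_𝕜)
    (hD₁ : ∀ x : E, 0 ≤ re ⟪D₁ x, x⟫_𝕜) (hM₁' : ∀ x : E, re ⟪G₁ x, x⟫_𝕜 ≤ M₁ * re ⟪D₁ x, x⟫_𝕜)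
    (h₁ : ∀ w : E, 2 * re ⟪G₁ w, A w⟫_𝕜 + c * re ⟪G₂ w, w⟫_𝕜 ≤ 2 * ω * re ⟪G₁ w, w⟫_𝕜)
    (h₂ : ∀ w : E, re ⟪G₂ w, A w⟫_𝕜 ≤ ω * re ⟪G₂ w, w⟫_𝕜)
    {lam ε : ℝ} (hgap : ω < 2 * lam) (hlam : 0 ≤ lam) (hε : 0 < ε)
    {calg : ℝ} (hcalg : 0 ≤ calg)
    (hB : ∀ x y : E, Real.sqrt (re ⟪D₁ (B x y), B x y⟫_𝕜) ≤ calg * ‖x‖ * ‖y‖)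
    {u : ℝ → E} {T₀ : ℝ} (hu : ContinuousOn u (Icc 0 T₀))
    (hBu : ContinuousOn (fun s => B (u s) (u s)) (Icc 0 T₀))
    (hderiv : ∀ s ∈ Ioo 0 T₀, HasDerivAt u (A (u s) + B (u s) (u s)) s)
    {η C' : ℝ}
    (hslack : ∀ t ∈ Icc 0 T₀, |‖exp (t • A) (u 0)‖ - ε * Real.exp (lam * t)| ≤ η)
    (hC' : Real.sqrt (M₁ / (c * m₂)) * calg * Real.sqrt (Real.pi / (2 * lam - ω)) *
        ((3 / 2 : ℝ) * ε) ^ 2 + η ≤ C' * ((3 / 2 : ℝ) * ε) ^ 2)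
    (hsmall : ∀ t ∈ Icc 0 T₀, C' * (3 / 2 : ℝ) ^ 2 * (ε * Real.exp (lam * t)) < 3 / 2 - 1)
    {t : ℝ} (ht : t ∈ Icc 0 T₀) :
    ‖u t‖ ≤ 3 / 2 * (ε * Real.exp (lam * t)) := by
  have hS : 0 ≤ Real.sqrt (M₁ / (c * m₂)) := Real.sqrt_nonneg _
  have hT := smoothing_bound_linearFlow A hG₁ hG₂ hG₁pos hc hm₂ hM₁ hm₂' hD₁ hM₁' h₁ h₂
  have hmild := mild_formula_of_classical A (fun x => B x x) hu hBu hderiv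
  have ha : ∀ s ∈ Icc 0 T₀, ε ≤ ε * Real.exp (lam * s) := fun s hs =>
    le_prediction_of_nonneg_rate hε.le hlam hs.1
  have h := (floor_of_mild_slack (p := fun x => Real.sqrt (re ⟪D₁ x, x⟫_𝕜))
    (T := fun τ x => exp (τ • A) x) (B := B) (u := u) (ℓ := fun t => exp (t • A) (u 0))
    hS hcalg hgap hε (by norm_num : (1:ℝ) ≤ 3 / 2) hε hT hB hu hmild hslack ha hC' hsmall t ht).2
  -- `a + C'(Q a)² ≤ (3/2) a` from the window condition `C' Q² a < 1/2`
  set a := ε * Real.exp (lam * t) with ha_def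
  have ha0 : 0 < a := by positivity
  have hwin := hsmall t ht
  have hq : C' * ((3 / 2 : ℝ) * a) ^ 2 = (C' * (3 / 2 : ℝ) ^ 2 * a) * a := by ring
  rw [hq] at h
  nlinarith [h, hwin, ha0]

end Summit.NavierStokesRegularity.FluidComputer.GalerkinEmergenceUpper

end
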